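import Summits.BirchSwinnertonDyer.BirchSwinnertonDyer.Theorems.GenusKolyvaginAtTwoGenusDeepSupplyAtTwoNegDiscNarrowKFourCellShaCardCurrency
import Summits.BirchSwinnertonDyer.BirchSwinnertonDyer.Theorems.GenusKolyvaginAtTwoExactDescentAtTwoOfFourFactsClosed
import HarnessLib

/-!
# Route `GenusKolyvaginAtTwo`, supply crux 23491 `GenusDeepSupplyAtTwoNegDiscNarrow` — THE KERNELS K₁ (31525) / K₄ (31526) IN LEAF CURRENCY,
# PER CURVE: on their frames K1Neg-at-`E` ⟺ `BSD₂(E)` and K4Neg-at-`E` ⟺ `BSD₂(E)`, modulo the twin's `BSD₂`, PRINT and (for K₄) Q2 + the cut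

LEAD seat `bsd-line-gk2-p1` g24 (cell `bsd-f1-sign2`), `--supports stmt-BirchSwinnertonDyer-23491 --as helper`.  THEOREMS ONLY (no definition, no
named fact, no `sorry`).  **BSD is NOT proved by this file; nothing is closed; every theorem is CONDITIONAL on `BSDp Wd 2` for the rank-one twin
(an instance of U₂ `MinimalTwinBSDTwo`, stmt-22985) and on the route's PRINT items** (`GrossZagierAllLevels` 24148, `EntireLFunctionRat` 19273,
`MultPublishedInputsAtTwo` 19921, `MilneAnyModel` 24149).

WHAT.  gk2-p5 g34/g36 proved the kernels LOSSLESS (leaf ⟹ kernel, `…SupplyKernelsLossless`, `…KFourCellHalvingDescentKFourNeg` §4); the route ledger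
is the converse.  Read PER CURVE both directions only ever use `BSD₂` of the TWO members of the Heegner pair, so on a fixed frame:
* §1 `depth_eq_zero_iff_bsdp_of_natCard_selmerGroup_eq_one` — K₁ cells (`#Sel₂(E) = 1`, BOTH signs, no cut, no Q2): **`M₀ = 0 ↔ BSDp W 2`**
  given `BSDp Wd 2` + PRINT (→: `Ш(E/K)[2^∞] = 0` at depth zero, 31538, then `ExactDescentAtTwo`, 24238; ←: Lossless §2 `#Ш(E/K)[2^∞] = 4^(M₀)` vs
  §1 `= 1`).  So K1Neg/K1Pos at `E` («`1 ≤ M₀` is absurd») are EXACTLY `BSD₂(E)` given `BSD₂(E^(d_K))`.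
* §2 `kFourNeg_conclusion_iff_bsdp` — the K₄ cell of 23491 on the cut, mod Q2: **K4Neg's conclusion at `E` ↔ BSDp W 2** given `BSDp Wd 2` + PRINT
  (→: witness ⟹ `#Ш(E/K)[2^∞] = 4^(M₀)` (p773559 §4, Kolyvagin exactness) ⟹ `ExactDescentAtTwo`; ←: Lossless §2 ⟹ `#Ш(E/K)[2^∞] = 4^(M₀)` ⟹
  p773559 §4 `kFourNeg_conclusion_of_pow_dvd_natCard_sha_baseChange`).
READING (LEAD census, now per curve in the kernel): on its cells the supply crux's beyond-print content K₁ ∧ K₄ is, curve by curve, `BSD₂(E)` for the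
rank-`0` member GIVEN `BSD₂` of the rank-`1` twin — the line neither over- nor under-claims; K₄ at depth ≥ 2 is open exactly because `BSD₂(E)` is.
BSD is NOT proved by any of this.

References: [GrossZagier1986] V.§2 (2.2); [Milne1972ArithmeticAV] §1 Thm. 1; [Kramer1981] Thm. 1; [McCallumLMS1991] §5 Thm. 5.4; [Kolyvagin1991MathAnn]
Thm. 1; [Miller2011LMS] Def. 1.1.
-/

set_option autoImplicit false
-- the Theorems namespace of this sub repeats the summit name by design (D-0017 nested layout)
set_option linter.dupNamespace false

noncomputable section

open scoped Classical

namespace Summit.BirchSwinnertonDyer.BirchSwinnertonDyer.Theorems.GenusSupplyNarrow.KFourCell.LeafCurrency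

open WeierstrassCurve NumberField IsDedekindDomain Field Literature.NumberTheory.EllipticCurves
  Literature.NumberTheory.GaloisRepresentations Literature.NumberTheory.EllipticCurves.ModularForms
open Summit.BirchSwinnertonDyer.BirchSwinnertonDyer.Theses.GenusKolyvaginAtTwo
  (KolyvaginRelationAtTwo GrossZagierAllLevels EntireLFunctionRat MultPublishedInputsAtTwo MilneAnyModel ExactDescentAtTwo)
open Summit.BirchSwinnertonDyer.BirchSwinnertonDyer.Theorems.GenusSupplyNarrow
open Summit.BirchSwinnertonDyer.BirchSwinnertonDyer.Theorems.GenusSupplyNarrow.KFourCell.ShaCardCurrency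

/-! ## §1 K₁ cells: depth zero ⟺ `BSD₂(E)` -/

/-- **K₁ IN LEAF CURRENCY, per curve.**  `E/ℚ` globally minimal, non-CM, `r_an(E) = 0`, `ρ_{E,2^n}` onto, `C(E)` odd, `#Sel₂(E) = 1`; `K` imaginary
quadratic, `d_K` odd `≠ −3`, Heegner; an odd-Manin `Dt`; `P(1)` of infinite order with `2^(M₀) ∥ P(1)`; a globally minimal twin `Wd ≅ E^(d_K)` of analytic
rank `1` with `#Sel₂(Wd) = 2` inside the sign's budget (`Δ<0 ∧ ord₂C(Wd) ≤ 1` or `Δ>0 ∧ ord₂C(Wd) = 0`).  Then, GIVEN `BSDp Wd 2` and the four PRINT items: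
**`M₀ = 0 ↔ BSDp W 2`** (→ via 31538 + `ExactDescentAtTwo`; ← via Lossless §2/§1).  So K1Neg/K1Pos at `E` say exactly `BSD₂(E)`.  CONDITIONAL; BSD is NOT
proved by this. [cite: GrossZagier1986, V.§2 (2.2)] [cite: Milne1972ArithmeticAV, §1 Thm. 1] [cite: Kramer1981, Thm. 1] [cite: Miller2011LMS, Def. 1.1] -/
theorem depth_eq_zero_iff_bsdp_of_natCard_selmerGroup_eq_one
    (hGZ : GrossZagierAllLevels) (hL : EntireLFunctionRat) (hGZK : MultPublishedInputsAtTwo) (hMi : MilneAnyModel)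
    (W : WeierstrassCurve ℚ) [W.IsElliptic] [W.IsGloballyMinimal] [NeZero (W.conductorNorm ℤ)] (hcm : ¬ W.HasCM) (hr0 : W.analyticRank = 0)
    (hρ : ∀ n : ℕ, 0 < n → W.HasSurjectiveModNGaloisRep ((2 : ℤ) ^ n)) (hT : Odd W.tamagawaProduct) (h1 : Nat.card (W.selmerGroup 2) = 1)
    (K : Type) [Field K] [NumberField K] (hIQ : IsImaginaryQuadratic K) (hodd : Odd (NumberField.discr K))
    (h3 : NumberField.discr K ≠ -3) (hHe : SatisfiesHeegnerHypothesis (W.conductorNorm ℤ) K)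
    (Dt : ModularParametrizationData W (W.conductorNorm ℤ))
    (hopt : ∀ z ∈ Dt.L.lattice, ∃ w ∈ periodLattice Dt.f, z = (Dt.c : ℂ) * w) (hc : Odd Dt.c)
    (β : ℤ) (ι : K →+* ℂ) (d₁ : KolyvaginHeegnerData Dt β ι 1) (hy : ¬ IsOfFinAddOrder d₁.derivedPoint) (M₀ : ℕ)
    (hdiv : ∃ Q : (W.baseChange (ringClassField K ι 1)).toAffine.Point, ((2 ^ M₀ : ℕ) : ℤ) • Q = d₁.derivedPoint)
    (hndiv : ¬ ∃ Q : (W.baseChange (ringClassField K ι 1)).toAffine.Point, ((2 ^ (M₀ + 1) : ℕ) : ℤ) • Q = d₁.derivedPoint)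
    (Wd : WeierstrassCurve ℚ) [Wd.IsElliptic] [Wd.IsGloballyMinimal]
    (hWd : ∃ C : VariableChange ℚ, C • W.quadraticTwist (NumberField.discr K : ℚ) = Wd) (hrd : Wd.analyticRank = 1)
    (hSel : Nat.card (Wd.selmerGroup 2) = 2)
    (hbudget : (W.Δ < 0 ∧ padicValNat 2 Wd.tamagawaProduct ≤ 1) ∨ (0 < W.Δ ∧ padicValNat 2 Wd.tamagawaProduct = 0))
    (hBd : BSDp Wd 2) :
    M₀ = 0 ↔ BSDp W 2 := by
  haveI : Fact (Nat.Prime 2) := ⟨Nat.prime_two⟩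
  have hρ2 : W.HasSurjectiveModNGaloisRep 2 := by simpa using hρ 1 one_pos
  have hG : ExactDescentAtTwo := GenusExactDescent.exactDescentAtTwoOfFourFacts_proof ⟨hGZ, hGZK, hL, hMi⟩
  constructor
  · rintro rfl
    -- depth zero: `Ш(E/K)[2^∞] = 0` (31538), then the quadratic `2`-descent of exactness (24238)
    have hSha : Nat.card (AddCommGroup.primaryComponent (W.baseChange K).sha 2) = 2 ^ (2 * 0) := by
      rw [mul_zero, pow_zero]
      exact Lossless.natCard_primaryComponent_sha_baseChange_two_eq_one_of_natCard_selmerGroup_eq_one W K hT hr0 h1 hIQ hodd hHe hρ2 Dt β ι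
        d₁ hy 0 hndiv Wd hWd hSel hbudget
    exact hG W hcm hr0 hρ hT K hIQ hodd h3 hHe Dt hopt hc β ι d₁ hy 0 hdiv hndiv hSha Wd hWd hSel hBd
  · intro hBW
    -- `BSD₂` of the pair gives `#Ш(E/K)[2^∞] = 4^(M₀)`; depth-zero cells have `#Ш(E/K)[2^∞] = 1`
    have hpow := Lossless.natCard_primaryComponent_sha_baseChange_two_eq_pow_of_bsdp_pair hGZ hL hGZK hMi W hρ2 hT hr0 K hIQ hodd h3 hHe Dt
      hc β ι d₁ M₀ hdiv hndiv Wd hWd hrd hBW hBd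
    have hone := Lossless.natCard_primaryComponent_sha_baseChange_two_eq_one_of_natCard_selmerGroup_eq_one W K hT hr0 h1 hIQ hodd hHe hρ2 Dt
      β ι d₁ hy M₀ hndiv Wd hWd hSel hbudget
    rw [hone] at hpow
    have h0 : 2 * M₀ = 0 := (Nat.pow_right_injective le_rfl (hpow.symm.trans (pow_zero 2).symm))
    omega

/-! ## §2 The K₄ cell of 23491 (cut, mod Q2): K4Neg-at-`E` ⟺ `BSD₂(E)` -/

/-- **K₄ IN LEAF CURRENCY, per curve.**  On K4Neg's frame (binders VERBATIM: habitat, `Δ < 0`, `#Sel₂(E) = 4`, prime Heegner frame, odd-Manin `Dt`,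
`2^(M₀) ∥ P(1)`, `1 ≤ M₀`, globally minimal twin of analytic rank `1` with `#Sel₂(Wd) = 2`, `ord₂ C(Wd) ≤ 1`) + one odd multiplicative prime + Q2, GIVEN
`BSDp Wd 2` and the four PRINT items: **K4Neg's conclusion at `E` ↔ BSDp W 2**.  (→: Kolyvagin exactness `#Ш(E/K)[2^∞] = 4^(M₀)` from the witness
(p773559 §4) feeds `ExactDescentAtTwo` (24238); ←: `BSD₂` of the pair gives `#Ш(E/K)[2^∞] = 4^(M₀)` (Lossless §2), and p773559 §4 turns
`4^(M₀) ∣ #Ш(E/K)[2^∞]` into the witness.)  So the beyond-print kernel K₄ of the Δ<0 supply is, curve by curve on the cut, `BSD₂(E)` for the rank-`0`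
member given `BSD₂(E^(d_K))`.  CONDITIONAL; BSD is NOT proved by this; K4Neg is NOT proved by this.
[cite: McCallumLMS1991, §5 Thm. 5.4] [cite: Kolyvagin1991MathAnn, Thm. 1] [cite: GrossZagier1986, V.§2 (2.2)] [cite: Milne1972ArithmeticAV, §1 Thm. 1] -/
theorem kFourNeg_conclusion_iff_bsdp
    (hGZ : GrossZagierAllLevels) (hL : EntireLFunctionRat) (hGZK : MultPublishedInputsAtTwo) (hMi : MilneAnyModel) (hQ2 : KolyvaginRelationAtTwo)
    (W : WeierstrassCurve ℚ) [W.IsElliptic] [W.IsGloballyMinimal] [NeZero (W.conductorNorm ℤ)] (hcm : ¬ W.HasCM)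
    (hr0 : W.analyticRank = 0) (hρ : ∀ n : ℕ, 0 < n → W.HasSurjectiveModNGaloisRep ((2 : ℤ) ^ n)) (hT : Odd W.tamagawaProduct)
    (hneg : W.Δ < 0) (h4 : Nat.card (W.selmerGroup 2) = 4)
    (K : Type) [Field K] [NumberField K] (hIQ : IsImaginaryQuadratic K) (hodd : Odd (NumberField.discr K))
    (h3 : NumberField.discr K ≠ -3) (hHe : SatisfiesHeegnerHypothesis (W.conductorNorm ℤ) K)
    (hsq1 : ¬ IsSquare ((NumberField.discr K : ℚ) * -|W.Δ|)) (hsq2 : ¬ IsSquare ((NumberField.discr K : ℚ) * (-(2 * |W.Δ|))))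
    (ℓ₀ : ℕ) (hℓ₀ : ℓ₀.Prime) (hdK : NumberField.discr K = -(ℓ₀ : ℤ))
    (h2K : ((Ideal.span {(2 : ℤ)}).primesOver (𝓞 K)).ncard = 2)
    (Dt : ModularParametrizationData W (W.conductorNorm ℤ))
    (hopt : ∀ z ∈ Dt.L.lattice, ∃ w ∈ periodLattice Dt.f, z = (Dt.c : ℂ) * w) (hc : Odd Dt.c)
    (β : ℤ) (ι : K →+* ℂ) (d₁ : KolyvaginHeegnerData Dt β ι 1) (hy : ¬ IsOfFinAddOrder d₁.derivedPoint) (M₀ : ℕ)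
    (hdiv : ∃ Q : (W.baseChange (ringClassField K ι 1)).toAffine.Point, ((2 ^ M₀ : ℕ) : ℤ) • Q = d₁.derivedPoint)
    (hndiv : ¬ ∃ Q : (W.baseChange (ringClassField K ι 1)).toAffine.Point, ((2 ^ (M₀ + 1) : ℕ) : ℤ) • Q = d₁.derivedPoint)
    (hM₀ : 1 ≤ M₀) (Wd : WeierstrassCurve ℚ) [Wd.IsElliptic] [Wd.IsGloballyMinimal]
    (hWd : ∃ C : VariableChange ℚ, C • W.quadraticTwist (NumberField.discr K : ℚ) = Wd) (hrd : Wd.analyticRank = 1)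
    (hSel : Nat.card (Wd.selmerGroup 2) = 2) (hDEF : padicValNat 2 Wd.tamagawaProduct ≤ 1)
    (v : HeightOneSpectrum (𝓞 ℚ)) (h2v : ((2 : ℕ) : 𝓞 ℚ) ∉ v.asIdeal) (hNv : ((W.conductorNorm ℤ : ℕ) : 𝓞 ℚ) ∈ v.asIdeal)
    (hmult : W.HasMultiplicativeReductionAt v)
    (hBd : BSDp Wd 2) :
    (∃ (n : ℕ) (d : KolyvaginHeegnerData Dt β ι n), Squarefree n ∧
      (∀ ℓ ∈ n.primeFactors, Zhang2014.IsKolyvaginPrime (W.conductorNorm ℤ) W K 2 ℓ ∧ 2 ≤ Zhang2014.kolyvaginIndex W 2 ℓ ∧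
        FrobEqFrobInfty W K 2 ℓ) ∧
      ¬ ∃ Q : (W.baseChange (ringClassField K ι n)).toAffine.Point, (2 : ℤ) • Q = d.derivedPoint) ↔
    BSDp W 2 := by
  haveI : Fact (Nat.Prime 2) := ⟨Nat.prime_two⟩
  have hρ2 : W.HasSurjectiveModNGaloisRep 2 := by simpa using hρ 1 one_pos
  have hG : ExactDescentAtTwo := GenusExactDescent.exactDescentAtTwoOfFourFacts_proof ⟨hGZ, hGZK, hL, hMi⟩
  constructor
  · intro hK4
    -- Kolyvagin exactness from the witness, then the quadratic `2`-descent of exactness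
    have hSha := natCard_sha_baseChange_two_eq_pow_of_kFourNeg_witness hQ2 W hcm hr0 hρ hT hneg h4 K hIQ hodd h3 hHe hsq1 hsq2 ℓ₀ hℓ₀ hdK
      h2K Dt hopt hc β ι d₁ hy M₀ hdiv hndiv hM₀ Wd hWd hrd hSel hDEF v h2v hNv hmult hK4
    exact hG W hcm hr0 hρ hT K hIQ hodd h3 hHe Dt hopt hc β ι d₁ hy M₀ hdiv hndiv hSha Wd hWd hSel hBd
  · intro hBW
    -- `BSD₂` of the pair gives `#Ш(E/K)[2^∞] = 4^(M₀)`; its divisibility half is the witness (p773559 §4)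
    have hpow := Lossless.natCard_primaryComponent_sha_baseChange_two_eq_pow_of_bsdp_pair hGZ hL hGZK hMi W hρ2 hT hr0 K hIQ hodd h3 hHe Dt
      hc β ι d₁ M₀ hdiv hndiv Wd hWd hrd hBW hBd
    exact kFourNeg_conclusion_of_pow_dvd_natCard_sha_baseChange hQ2 W hcm hr0 hρ hT hneg h4 K hIQ hodd h3 hHe hsq1 hsq2 ℓ₀ hℓ₀ hdK h2K Dt
      hopt hc β ι d₁ hy M₀ hdiv hndiv hM₀ Wd hWd hrd hSel hDEF v h2v hNv hmult (by rw [hpow])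

end Summit.BirchSwinnertonDyer.BirchSwinnertonDyer.Theorems.GenusSupplyNarrow.KFourCell.LeafCurrency

end
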